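import Summits.Parity.GeneralizedHardyLittlewood.Theorems.PrimeLevelFamEdgeMomentsBeyondDiagonalDiagPTerm
import Summits.Parity.GeneralizedHardyLittlewood.Theorems.PrimeLevelFamEdgeMomentsBeyondDiagonalDiagProfile
import HarnessLib

/-!
# Route `PrimeLevelFamEdge`, crux K_A `MomentsBeyondDiagonal` (stmt-Parity-20007), line «petersson_layers» v4, stub `stub_diag`:
# **the continued kernel form of a general admissible profile:
# `Σ_{a,b≤M} x_a x_b K_L(a,b) = ζ(2)²·(P′(1)² + (L/log M)∫₀¹P″²)/log²M + O_P(log⁻³M)`**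

Census item G8 at `Q = 1` (assembly of the general-profile kernel chain) of the `stub_diag` repair census
(`Lines/petersson_layers_stub_diag_g4_bricks.md`): K_B's `KernelFormXSq.kernelForm_xsq_asymp`
(`4ζ(2)²(L/log M + 1)/log²M` at `P = X²`) for EVERY real polynomial profile `P` with `P(0) = P′(0) = 0`.
With `x_m = μ(m)ψ(m)⁻¹P(log(M/m)/log M)` (`= m^{1/2}·KMV2000.mollifierCoeff P M m`) and KMV's continued kernel
`K_L = KMV2000.kmvKernel L`:

* `kernelForm_profile_asymp` — **`|Σ_{a,b≤M} x_a x_b K_L(a,b) − ζ(2)²(P′(1)² + (L/log M)·∫₀¹P″(u)²du)/log²M| ≤ C_P/log³M`**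
  for `M ≥ 3`, `0 ≤ L ≤ log M` — `quadForm_profile_eq` (Selberg coordinates) + `abs_LTerm_sub_le` (`…DiagLTerm`)
  + `abs_PTerm_sub_le` (`…DiagPTerm`);
* `secondMomentForm_div_one` — `KMV2000.secondMomentForm (ℓ/L) P 1 = P′(1)² + (L/ℓ)∫₀¹P″²`;
* `kernelForm_profile_asymp_admissible` — the same for `KMV2000.Admissible P`, main term
  `ζ(2)²·secondMomentForm (log M/L) P 1/log²M`: at `M = q̂^{Δ'}`, `L = log q̂` this is KMV's printed second-moment
  bracket (31) at `Q = 1`, `Δ = Δ'`, i.e. the diagonal main term CONTINUES the printed form beyond the diagonal for every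
  admissible profile (the `X²` instance is `…DiagXSqOne`).

Def-free; theorems only. Helper `--supports stmt-Parity-20007`; closes nothing (the registered stub quantifies over every
even-or-odd `Q`; the corner `K_true − K_L` for general `P` and the general-`Q` sums remain); K_A, K_B and the Parity summit
are NOT proved; nothing about Landau–Siegel zeros.

## References
* E. Kowalski, P. Michel, J. VanderKam, J. reine angew. Math. 526 (2000), (21)–(23) pp. 12–13, Prop. 5.1 (31) p. 18.
  [cite: KowalskiMichelVanderKam2000, Prop. 5.1 — derivation (general profile, Q = 1, continued kernel)]
-/

noncomputable section

open scoped Real ArithmeticFunction.Moebius ArithmeticFunction.sigma ArithmeticFunction.zeta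
open Finset ArithmeticFunction Polynomial MeasureTheory intervalIntegral

namespace Summit.Parity.GeneralizedHardyLittlewood.Theorems.MomentsBeyondDiagonal.DiagKernel

open Literature.NumberTheory.LFunctions Literature.NumberTheory.LFunctions.KMV2000
open MollifierMainTerm (W)
open SelbergCoord (kappa)
open Literature.NumberTheory.Sieve (one_le_log_of_three_le)
open Summit.Parity.GeneralizedHardyLittlewood.Theorems.BeyondDiagonalBeatsQuarter.KernelFormXSq (copTauW mainConst)

/-- `Admissible P` (`P(0) = P′(0) = 0`) in coefficients: `P₀ = P₁ = 0`. [folklore] -/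
theorem coeff_zero_one_of_admissible {P : ℝ[X]} (hP : Admissible P) : P.coeff 0 = 0 ∧ P.coeff 1 = 0 := by
  refine ⟨by rw [Polynomial.coeff_zero_eq_eval_zero]; exact hP.1, ?_⟩
  have := hP.2
  rw [← Polynomial.coeff_zero_eq_eval_zero, Polynomial.coeff_derivative] at this
  simpa using this

/-- **`secondMomentForm (ℓ/L) P 1 = P′(1)² + (L/ℓ)·∫₀¹P″(u)²du`** (KMV's (31) bracket at `Q = 1`, `Δ = ℓ/L`).
[cite: KowalskiMichelVanderKam2000, §6 (31)–(32) at Q = 1] -/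
theorem secondMomentForm_div_one (P : ℝ[X]) (ℓ L : ℝ) :
    secondMomentForm (ℓ / L) P 1 =
      (derivative P).eval 1 ^ 2 + L / ℓ * ∫ u in (0 : ℝ)..1, ((derivative (derivative P)).eval u) ^ 2 := by
  rw [secondMomentForm, linForm_one, offDiagForm_one, inv_div, unitIntegral]
  congr 2
  exact intervalIntegral.integral_congr fun u _ ↦ by simp [Polynomial.eval_pow]

/-- **The continued kernel form of a general profile.** For a real polynomial `P` with `P₀ = P₁ = 0` there is `C_P`
such that for all `M ≥ 3` and `0 ≤ L ≤ log M`, with `x_m = μ(m)ψ(m)⁻¹P(log(M/m)/log M)`,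
`|Σ_{a,b≤M} x_a x_b·kmvKernel L a b − ζ(2)²·(P′(1)² + (L/log M)·∫₀¹P″(u)²du)/log²M| ≤ C_P/log³M`.
[cite: KowalskiMichelVanderKam2000, Prop. 5.1 — derivation (general profile, Q = 1, continued kernel)] -/
theorem kernelForm_profile_asymp (P : ℝ[X]) (hP0 : P.coeff 0 = 0) (hP1 : P.coeff 1 = 0) :
    ∃ C : ℝ, 0 < C ∧ ∀ M : ℝ, 3 ≤ M → ∀ L : ℝ, 0 ≤ L → L ≤ Real.log M →
      |∑ a ∈ Icc 1 ⌊M⌋₊, ∑ b ∈ Icc 1 ⌊M⌋₊,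
          ((μ a : ℝ) * ((psi a)⁻¹ * P.eval (Real.log (M / a) / Real.log M))) *
            ((μ b : ℝ) * ((psi b)⁻¹ * P.eval (Real.log (M / b) / Real.log M))) * kmvKernel L a b -
        (π ^ 2 / 6) ^ 2 * ((derivative P).eval 1 ^ 2 +
          L / Real.log M * ∫ u in (0 : ℝ)..1, ((derivative (derivative P)).eval u) ^ 2) / Real.log M ^ 2| ≤
        C / Real.log M ^ 3 := by
  obtain ⟨C₁, hC₁, h1⟩ := abs_LTerm_sub_le P hP0 hP1
  obtain ⟨C₂, hC₂, h2⟩ := abs_PTerm_sub_le P hP0 hP1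
  refine ⟨C₁ + C₂, by positivity, fun M hM L hL0 hLℓ ↦ ?_⟩
  have hA := h1 M hM L hL0 hLℓ
  have hB := h2 M hM
  rw [quadForm_profile_eq P M L]
  -- abbreviations
  obtain ⟨S, hS⟩ : ∃ S : ℕ → ℝ, ∀ n, S n = ∑ c ∈ Finset.range (P.natDegree + 1), P.coeff c *
    ((∑ k ∈ Icc 1 ⌊M / n⌋₊, copTauW n k * Real.log (M / n / k) ^ c) / Real.log M ^ c) := ⟨_, fun _ ↦ rfl⟩
  simp only [← hS] at hA hB ⊢
  obtain ⟨Pc, hPc⟩ : ∃ Pc : ℕ → ℝ, ∀ n, Pc n = ∑ j ∈ Icc 1 (⌊M⌋₊ / n),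
      (if j.Prime ∧ ¬ j ∣ n then Real.log j / ((j : ℝ) + 1) * S (n * j) else 0) := ⟨_, fun _ ↦ rfl⟩
  simp only [← hPc] at hB ⊢
  set ℓ := Real.log M with hℓ
  set N := ⌊M⌋₊ with hN
  set I : ℝ := ∫ u in (0 : ℝ)..1, ((derivative (derivative P)).eval u) ^ 2 with hI
  set a : ℝ := (derivative P).eval 1 ^ 2 with ha
  have hsplit : ∑ n ∈ Icc 1 N, (Nat.totient n : ℝ) * W n ^ 2 * ((L + kappa n) * S n ^ 2 + 2 * (S n * Pc n)) =
      ∑ n ∈ Icc 1 N, (Nat.totient n : ℝ) * W n ^ 2 * ((L + kappa n) * S n ^ 2) +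
        ∑ n ∈ Icc 1 N, (Nat.totient n : ℝ) * W n ^ 2 * (2 * (S n * Pc n)) := by
    rw [← Finset.sum_add_distrib]
    exact Finset.sum_congr rfl fun n _ ↦ by ring
  have htarget : (π ^ 2 / 6) ^ 2 * (a + L / ℓ * I) / ℓ ^ 2 =
      (π ^ 2 / 6) ^ 2 * L * I / ℓ ^ 3 + (π ^ 2 / 6) ^ 2 * a / ℓ ^ 2 := by ring
  rw [hsplit, htarget]
  calc _ ≤ |∑ n ∈ Icc 1 N, (Nat.totient n : ℝ) * W n ^ 2 * ((L + kappa n) * S n ^ 2) -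
            (π ^ 2 / 6) ^ 2 * L * I / ℓ ^ 3| +
          |∑ n ∈ Icc 1 N, (Nat.totient n : ℝ) * W n ^ 2 * (2 * (S n * Pc n)) - (π ^ 2 / 6) ^ 2 * a / ℓ ^ 2| := by
        rw [show ∀ x y s t : ℝ, x + y - (s + t) = (x - s) + (y - t) from fun x y s t ↦ by ring]
        exact abs_add_le _ _
    _ ≤ C₁ / ℓ ^ 3 + C₂ / ℓ ^ 3 := add_le_add hA hB
    _ = (C₁ + C₂) / ℓ ^ 3 := by ring

/-- **The continued kernel form of an admissible profile, KMV form.** For `KMV2000.Admissible P` there is `C_P` such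
that for all `M ≥ 3` and `0 ≤ L ≤ log M`, with `x_m = μ(m)ψ(m)⁻¹P(log(M/m)/log M)`,
`|Σ_{a,b≤M} x_a x_b·kmvKernel L a b − ζ(2)²·secondMomentForm (log M/L) P 1/log²M| ≤ C_P/log³M`
(at `M = q̂^{Δ'}`, `L = log q̂`: `log M/L = Δ'`, the printed bracket (31) at `Q = 1` continued beyond the diagonal).
[cite: KowalskiMichelVanderKam2000, Prop. 5.1 (31) — derivation (general admissible profile, Q = 1)] -/
theorem kernelForm_profile_asymp_admissible {P : ℝ[X]} (hP : Admissible P) :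
    ∃ C : ℝ, 0 < C ∧ ∀ M : ℝ, 3 ≤ M → ∀ L : ℝ, 0 ≤ L → L ≤ Real.log M →
      |∑ a ∈ Icc 1 ⌊M⌋₊, ∑ b ∈ Icc 1 ⌊M⌋₊,
          ((μ a : ℝ) * ((psi a)⁻¹ * P.eval (Real.log (M / a) / Real.log M))) *
            ((μ b : ℝ) * ((psi b)⁻¹ * P.eval (Real.log (M / b) / Real.log M))) * kmvKernel L a b -
        (π ^ 2 / 6) ^ 2 * secondMomentForm (Real.log M / L) P 1 / Real.log M ^ 2| ≤ C / Real.log M ^ 3 := by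
  obtain ⟨hP0, hP1⟩ := coeff_zero_one_of_admissible hP
  obtain ⟨C, hC, h⟩ := kernelForm_profile_asymp P hP0 hP1
  refine ⟨C, hC, fun M hM L hL0 hLℓ ↦ ?_⟩
  rw [secondMomentForm_div_one]
  exact h M hM L hL0 hLℓ

end Summit.Parity.GeneralizedHardyLittlewood.Theorems.MomentsBeyondDiagonal.DiagKernel

end
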